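import Summits.BirchSwinnertonDyer.Rank1Residual.Additive.RamifiedOrdinaryLineInertiaScalars
import Summits.BirchSwinnertonDyer.Rank1Residual.X2.TateLineDecomposition
import HarnessLib

/-!
# MATCHING of ramified ordinary lines under a congruence `E[p] ≃ E₁[p]` — MODEL-FREE, off the
# numerical swap locus `(p − 1) ∣ lcm(n, n₁)` (every curve, every semistability defect, no twist
# model, no class hypothesis)

HONEST FRAMING (BSD rank-`≤ 1` residual cell `b2b-bsdres`, home
`run/shared/lean/b2b/bsd-rank1-residual/`, lane CLASS-CLOSURE, seat cc-typer-2 = typer of record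
N10 §3.2 / O7 §3.3, team n1011; typer-lane sequel S3 of S1 = `RamifiedOrdinaryLineUniqueModelFree`):
the cell deletes COMBINATION-SHAPED residual classes of the rank-`≤ 1` BSD formula from PUBLISHED
theorems only and TYPES the construction-shaped ones; research route, no claim beyond stated classes;
census output = EVIDENCE; nothing is booked by this file; no RESIDUAL-MAP mark moves. Theorems
only: NO definition, NO named fact, NO conjecture node.

WHAT. The line-MATCHING clause of a congruence between two additive potentially ordinary /
potentially multiplicative curves — `P ∈ C ↔ e P ∈ C₁` for every equivariant `e : E[p] ≃ E₁[p]`, the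
second half of the `TorsionIso` binder of the Greenberg–Vatsal transfer record
`GreenbergVatsal2000.muLambdaAlg_transfer_of_torsionIso_potOrd_of_not_dvd_torsionOrder` and the
hypothesis `hθL` of n1011-p12's `GreenbergVatsalTransferRamified` — is proved in the tree only from
MODELS: n1011-p07's `RamifiedOrdinaryLineMatching[Mixed]` (Tate / good-ordinary twist models, one
inertia element acting as `±2` on the line and `±1` on the quotient) on the four defect-`2` loci.
This file proves it for ANY two ramified ordinary lines (`IsRamifiedOrdinaryLine`, EPW §3.1 read on
the curve) from the predicate alone, under ONE numerical hypothesis: if inertia acts on `E[p^∞]/C`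
through exponent `n` and on `E₁[p^∞]/C₁` through exponent `n₁` (clause 4 of the predicate, made
explicit), and `(p − 1) ∤ lcm(n, n₁)`, then the lines match under every inertia-equivariant
`e : E[p] ≃+ E₁[p]`. MECHANISM (tool file `RamifiedOrdinaryLineInertiaScalars` + §1 here): an element `σ` of the local inertia group acts on the line
`C[p]` by a scalar `a` and on `E[p]` modulo `C` by a scalar `b` (cyclic groups of order `p`),
with `a·b ≡ χ_p(σ) (mod p)` by the Weil pairing on `E` itself (`det ρ̄ = ω`; the tree's
`WeierstrassCurve.localPoints_exists_isPrimitiveRoot_smul_eq_pow`, as in S1) and `bⁿ ≡ 1`; the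
same for `E₁` with `a₁ b₁ ≡ χ_p(σ)`, `b₁^{n₁} ≡ 1`. Choose `σ ∈ I_v` with `χ_p(σ) ≡ g₀` a PRIMITIVE
ROOT mod `p` (local Kronecker–Weber, `exists_mem_absInertia_cyclotomicCharacter_eq_natCast`): then
`a ≡ b₁` would give `g₀^{lcm(n,n₁)} ≡ (b₁ b)^{lcm} ≡ 1`, i.e. `(p − 1) ∣ lcm(n, n₁)` — excluded; so
`a ≢ b₁ (mod p)`, and p07's one-element argument with GENERAL scalars (§1: `σ·eP = a·eP`,
`σ·eP − b₁·eP ∈ C₁`, hence `(a − b₁)·eP ∈ C₁` and `eP ∈ C₁` by Bézout) gives `e(C[p]) ⊆ C₁`; the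
converse inclusion is the same with the roles exchanged (`a₁ ≢ b`).

SCOPE (honest): the hypothesis is SUFFICIENT, not necessary. With `n = n₁ = e` the semistability
defect: defect `2` needs `p ≥ 5` (`p = 3`, `e = 2` stays with p07's model theorems
`GreenbergVatsalTransferCountOdd.exists_lines_matching_of_typeGOrd_typeGOrd`,
`PotMult.exists_lines_matching`, which DO cover it); on the `Gord_e346` rows (`p ≥ 5`,
`p ≡ 1 (mod e)`) every `(e, p)` is covered except `(4, 5)` and `(6, 7)` — exactly the pairs where the
quotient character CAN be `ω` times the other line character (the genuine swap locus); mixed links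
`n ≠ n₁` whenever `(p − 1) ∤ lcm`. Only INERTIA-equivariance of `e` is used (the `Γ_ℚ`-equivariant
form is a corollary). Consumers: the `Gord_e346` congruence links of class-closure R3″ (once
n1011-p05's F-C supplies the lines, `N10/TRANSPORT-TEMPLATE.md` v1.6 limit (i)); a model-free
re-derivation of the defect-`2` matchings at `p ≥ 5`.

References: Greenberg–Vatsal, Invent. Math. 142 (2000) §2 p. 26 ("`C` is determined by the action
of `I_p`"), Remark (2.9) [GreenbergVatsal2000]; Emerton–Pollack–Weston (2006) pp. 2–3, §3.1 (the
congruence respects the `p`-stabilisations) [EmertonPollackWeston2006]; Silverman *AEC* III.8.1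
(Weil pairing, `det = χ`) [SilvermanAEC2009]; Serre, *Local Fields* IV §4 Prop. 17
[SerreLocalFields1979].
-/

noncomputable section

open scoped Classical AddSubgroup

open NumberField IsDedekindDomain Field
  Literature.NumberTheory.GaloisRepresentations
  Literature.NumberTheory.EllipticCurves
  Literature.NumberTheory.EllipticCurves.GreenbergSelmer
  Literature.NumberTheory.EllipticCurves.EmertonPollackWeston2006
  IsDedekindDomain.HeightOneSpectrum
  Summit.BirchSwinnertonDyer.Rank1Residual.X2
  Summit.BirchSwinnertonDyer.Rank1Residual.X2.GreenbergVatsalReductionDatum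
  Summit.BirchSwinnertonDyer.Rank1Residual.X2.GreenbergVatsalTateDatumCofree
  Summit.BirchSwinnertonDyer.Rank1Residual.X2.GreenbergVatsalTateDatumTorsion
  Summit.BirchSwinnertonDyer.Rank1Residual.X2.TrivialZeroCorankAlgebra
  Summit.BirchSwinnertonDyer.Rank1Residual.Additive.RamifiedOrdinaryLineUnique
  Summit.BirchSwinnertonDyer.Rank1Residual.Additive.RamifiedOrdinaryLineUniqueModelFree
  Summit.BirchSwinnertonDyer.Rank1Residual.AdditivePotMult.RamifiedLineUnique
open WeierstrassCurve (geomTorsion geomPrimaryTorsion geomTorsion_le_geomPrimaryTorsion)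

universe u

open Summit.BirchSwinnertonDyer.Rank1Residual.Additive.RamifiedOrdinaryLineInertiaScalars

namespace Summit.BirchSwinnertonDyer.Rank1Residual.Additive.RamifiedOrdinaryLineMatchingModelFree


variable {W W₁ : WeierstrassCurve ℚ} [W.IsElliptic] [W₁.IsElliptic] {p : ℕ} [hp : Fact p.Prime]
  {v : HeightOneSpectrum (𝓞 ℚ)}

/-! ## §1. One-element matching with GENERAL scalars (p07's mechanism, Bézout form) -/

omit [W.IsElliptic] hp in
/-- The inclusion `E[p] ↪ E[p^∞]` of a `p`-torsion point is killed by `p` (as p07's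
`RamifiedOrdinaryLineMatching.nsmul_inclusion_eq_zero`; private copy to keep the import cone).
[folklore] -/
private theorem nsmul_inclusion_eq_zero (P : ↥(geomTorsion W (p : ℤ))) :
    p • AddSubgroup.inclusion (geomTorsion_le_geomPrimaryTorsion W p) P = 0 :=
  Subtype.ext (by
    rw [AddSubmonoidClass.coe_nsmul, ZeroMemClass.coe_zero]
    exact AddSubgroup.torsionBy.nsmul_iff.mp P.2)

omit [W.IsElliptic] [W₁.IsElliptic] in
/-- **Matching from one element with general scalars.** If `g ∈ Γ_ℚ` acts on `C ∩ W[p]` as the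
scalar `a`, on `W₁[p]` modulo `C₁` as the scalar `b` (`g·y − b·y ∈ C₁` for `p·y = 0`), with
`a ≢ b (mod p)`, then every `e : W[p] ≃+ W₁[p]` commuting with `g` maps `C ∩ W[p]` into `C₁`:
`g·eP = a·eP` and `g·eP − b·eP ∈ C₁` give `(a − b)·eP ∈ C₁`, and `a − b` is invertible modulo the
order `p` of `eP`. (p07's `inclusion_apply_mem_of_pos/neg` are the cases `(a, b) = (±2, ±1)`.)
[cite: EmertonPollackWeston2006, pp. 2–3 and §3.1 (eq:ordes) (arXiv:math/0404484 p. 17)] -/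
theorem inclusion_apply_mem_of_scalars
    (L : LocalDatum ℚ ↥(W.geomPrimaryTorsion p) v) (L₁ : LocalDatum ℚ ↥(W₁.geomPrimaryTorsion p) v)
    (e : ↥(geomTorsion W (p : ℤ)) ≃+ ↥(geomTorsion W₁ (p : ℤ))) {g : absoluteGaloisGroup ℚ}
    (he : ∀ P : ↥(geomTorsion W (p : ℤ)), e (g • P) = g • e P) {a b : ℕ}
    (hline : ∀ m ∈ L.plus, p • m = 0 → g • m = a • m)
    (hquot₁ : ∀ y : ↥(W₁.geomPrimaryTorsion p), p • y = 0 → g • y - b • y ∈ L₁.plus)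
    (hab : (a : ZMod p) ≠ (b : ZMod p)) (P : ↥(geomTorsion W (p : ℤ)))
    (hP : AddSubgroup.inclusion (geomTorsion_le_geomPrimaryTorsion W p) P ∈ L.plus) :
    AddSubgroup.inclusion (geomTorsion_le_geomPrimaryTorsion W₁ p) (e P) ∈ L₁.plus := by
  set y := AddSubgroup.inclusion (geomTorsion_le_geomPrimaryTorsion W₁ p) (e P) with hy
  have hyp : p • y = 0 := nsmul_inclusion_eq_zero (e P)
  -- `g • y = a • y`
  have h1 := hline _ hP (nsmul_inclusion_eq_zero P)
  have h2 : g • P = a • P :=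
    Subtype.ext (by
      have h := congrArg Subtype.val h1
      simpa only [primaryComponent.coe_smul, AddSubmonoidClass.coe_nsmul,
        AddSubgroup.coe_inclusion, AddSubgroup.torsionBy.coe_smul] using h)
  have h3 : g • e P = a • e P := by rw [← he, h2, map_nsmul]
  have h4 : g • y = a • y := by
    rw [hy, ← TateLineDecomposition.inclusion_smul, h3, map_nsmul]
  -- `(a - b) • y ∈ C₁`
  have h5 : ((a : ℤ) - b) • y ∈ L₁.plus := by
    rw [sub_smul, natCast_zsmul, natCast_zsmul, ← h4]
    exact hquot₁ y hyp
  -- Bézout: `a - b` is prime to `p`, and `p • y = 0`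
  have hnd : ¬ (p : ℤ) ∣ (a : ℤ) - b := by
    intro hd
    apply hab
    have h := (ZMod.intCast_eq_intCast_iff_dvd_sub (b : ℤ) (a : ℤ) p).mpr hd
    simpa only [Int.cast_natCast] using h.symm
  have hcop : IsCoprime (p : ℤ) ((a : ℤ) - b) := by
    rw [Int.isCoprime_iff_gcd_eq_one, Int.gcd_eq_natAbs, Int.natAbs_natCast]
    exact (Nat.Prime.coprime_iff_not_dvd hp.out).mpr (fun h ↦ hnd (Int.ofNat_dvd_left.mpr h))
  obtain ⟨u, w, huw⟩ := hcop
  have hy1 : y = w • (((a : ℤ) - b) • y) := by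
    conv_lhs => rw [← one_zsmul y, ← huw]
    rw [add_zsmul, mul_zsmul, mul_zsmul, natCast_zsmul, hyp, zsmul_zero, zero_add]
  rw [hy1]
  exact L₁.plus.zsmul_mem h5 w

end Summit.BirchSwinnertonDyer.Rank1Residual.Additive.RamifiedOrdinaryLineMatchingModelFree

/-! ## §2. The matching theorem -/

namespace Literature.NumberTheory.EllipticCurves.EmertonPollackWeston2006.IsRamifiedOrdinaryLine

open Summit.BirchSwinnertonDyer.Rank1Residual.Additive.RamifiedOrdinaryLineMatchingModelFree
  Summit.BirchSwinnertonDyer.Rank1Residual.Additive.RamifiedOrdinaryLineInertiaScalars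
  Summit.BirchSwinnertonDyer.Rank1Residual.Additive.RamifiedOrdinaryLineUniqueModelFree

variable {W W₁ : WeierstrassCurve ℚ} [W.IsElliptic] [W₁.IsElliptic] {p : ℕ} [hp : Fact p.Prime]
  {v : HeightOneSpectrum (𝓞 ℚ)}

/-- **MATCHING OF RAMIFIED ORDINARY LINES UNDER A CONGRUENCE — model-free, off the numerical swap
locus.** `E = W`, `E₁ = W₁` elliptic over `ℚ`, `p` prime, `v ∋ p`; `L`, `L₁` ramified ordinary lines of
`E[p^∞]`, `E₁[p^∞]` at `v` (EPW §3.1 on the curve) on whose quotients the local inertia group acts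
through exponents `n`, `n₁`; assume `(p − 1) ∤ lcm(n, n₁)`. Then for EVERY additive isomorphism
`e : E[p] ≃ E₁[p]` commuting with the local inertia group and every `P ∈ E[p]`:
`P ∈ C ↔ e P ∈ C₁`. No twist model, no class hypothesis, no reduction type. (One `σ ∈ I_v` with
`χ_p(σ)` a primitive root mod `p`; line/quotient scalars `a, b` and `a₁, b₁`; `ab ≡ χ_p(σ) ≡ a₁b₁`
by the Weil pairing, `bⁿ ≡ 1 ≡ b₁^{n₁}` by clause 4; hence `a ≢ b₁` and `a₁ ≢ b`, and §1 applies in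
both directions.) GV p. 26 "`C` is determined by the action of `I_p`"; EPW pp. 2–3 "the congruence
respects the `p`-stabilisations". [cite: GreenbergVatsal2000, §2 p. 26 and Remark (2.9)]
[cite: EmertonPollackWeston2006, pp. 2–3 and §3.1 (eq:ordes) (arXiv:math/0404484 p. 17)]
[cite: SilvermanAEC2009, Prop. III.8.1] -/
theorem inclusion_mem_iff_of_not_dvd_lcm
    {L : LocalDatum ℚ ↥(W.geomPrimaryTorsion p) v} {L₁ : LocalDatum ℚ ↥(W₁.geomPrimaryTorsion p) v}
    (hL : IsRamifiedOrdinaryLine W p L) (hL₁ : IsRamifiedOrdinaryLine W₁ p L₁)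
    (hpv : ((p : ℕ) : 𝓞 ℚ) ∈ v.asIdeal) {n n₁ : ℕ}
    (hn : ∀ σ ∈ absInertia (v.adicCompletion ℚ), ∀ m : ↥(W.geomPrimaryTorsion p),
      (absGaloisRestrict ℚ (v.adicCompletion ℚ) σ) ^ n • m - m ∈ L.plus)
    (hn₁ : ∀ σ ∈ absInertia (v.adicCompletion ℚ), ∀ m : ↥(W₁.geomPrimaryTorsion p),
      (absGaloisRestrict ℚ (v.adicCompletion ℚ) σ) ^ n₁ • m - m ∈ L₁.plus)
    (hlcm : ¬ (p - 1) ∣ Nat.lcm n n₁)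
    (e : ↥(geomTorsion W (p : ℤ)) ≃+ ↥(geomTorsion W₁ (p : ℤ)))
    (he : ∀ σ ∈ absInertia (v.adicCompletion ℚ), ∀ P : ↥(geomTorsion W (p : ℤ)),
      e (absGaloisRestrict ℚ (v.adicCompletion ℚ) σ • P) =
        absGaloisRestrict ℚ (v.adicCompletion ℚ) σ • e P)
    (P : ↥(geomTorsion W (p : ℤ))) :
    AddSubgroup.inclusion (geomTorsion_le_geomPrimaryTorsion W p) P ∈ L.plus ↔
      AddSubgroup.inclusion (geomTorsion_le_geomPrimaryTorsion W₁ p) (e P) ∈ L₁.plus := by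
  -- one inertia element with `χ_p(σ)` a primitive root mod `p`
  obtain ⟨σ, hσI, g₀, hχ, u, hug₀, hu⟩ :=
    exists_mem_absInertia_cyclotomicCharacter_primitiveRoot (p := p) hpv
  set g := absGaloisRestrict ℚ (v.adicCompletion ℚ) σ with hg
  -- scalars on `E`
  obtain ⟨a, ha⟩ := exists_lineScalar hL σ
  obtain ⟨x, hx0, hxp, hxgen⟩ := exists_quotGenerator hL
  obtain ⟨b, hbx, hb⟩ := exists_quotScalar σ hxp hxgen
  have hbn : ((b : ZMod p)) ^ n = 1 := quotScalar_pow_eq_one σ (hn σ hσI) hx0 hxp hbx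
  have hab : ((b : ZMod p)) * (a : ZMod p) = (g₀ : ZMod p) :=
    quotScalar_mul_lineScalar_eq_of_cyclotomicCharacter_eq hL hχ ha hb
  -- scalars on `E₁`
  obtain ⟨a₁, ha₁⟩ := exists_lineScalar hL₁ σ
  obtain ⟨x₁, hx₁0, hx₁p, hx₁gen⟩ := exists_quotGenerator hL₁
  obtain ⟨b₁, hb₁x, hb₁⟩ := exists_quotScalar σ hx₁p hx₁gen
  have hb₁n : ((b₁ : ZMod p)) ^ n₁ = 1 := quotScalar_pow_eq_one σ (hn₁ σ hσI) hx₁0 hx₁p hb₁x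
  have hab₁ : ((b₁ : ZMod p)) * (a₁ : ZMod p) = (g₀ : ZMod p) :=
    quotScalar_mul_lineScalar_eq_of_cyclotomicCharacter_eq hL₁ hχ ha₁ hb₁
  rw [← hug₀] at hab hab₁
  -- separation
  have hsep : (a : ZMod p) ≠ (b₁ : ZMod p) := lineScalar_ne_quotScalar hab hu hbn hb₁n hlcm
  have hsep₁ : (a₁ : ZMod p) ≠ (b : ZMod p) :=
    lineScalar_ne_quotScalar hab₁ hu hb₁n hbn (by rwa [Nat.lcm_comm] at hlcm)
  refine ⟨fun hP ↦ inclusion_apply_mem_of_scalars L L₁ e (he σ hσI) ha hb₁ hsep P hP, fun hP ↦ ?_⟩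
  have he' : ∀ Q : ↥(geomTorsion W₁ (p : ℤ)), e.symm (g • Q) = g • e.symm Q := fun Q ↦
    e.injective (by rw [e.apply_symm_apply, he σ hσI, e.apply_symm_apply])
  have h := inclusion_apply_mem_of_scalars L₁ L e.symm he' ha₁ hb hsep₁ (e P) hP
  rwa [e.symm_apply_apply] at h

/-- **The `Γ_ℚ`-equivariant form** (the binder shape of the `TorsionIso` clause of
`GreenbergVatsal2000.muLambdaAlg_transfer_of_torsionIso_potOrd_of_not_dvd_torsionOrder` and of
n1011-p07's `RamifiedOrdinaryLineMatching.inclusion_mem_iff_of_shape`): for every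
`Γ_ℚ`-equivariant `e : E[p] ≃+ E₁[p]`, `P ∈ C ↔ e P ∈ C₁`, off the swap locus
`(p − 1) ∣ lcm(n, n₁)`. [cite: GreenbergVatsal2000, §2 p. 26 and Remark (2.9)]
[cite: EmertonPollackWeston2006, pp. 2–3 and §3.1 (eq:ordes) (arXiv:math/0404484 p. 17)] -/
theorem inclusion_mem_iff_of_not_dvd_lcm_of_equivariant
    {L : LocalDatum ℚ ↥(W.geomPrimaryTorsion p) v} {L₁ : LocalDatum ℚ ↥(W₁.geomPrimaryTorsion p) v}
    (hL : IsRamifiedOrdinaryLine W p L) (hL₁ : IsRamifiedOrdinaryLine W₁ p L₁)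
    (hpv : ((p : ℕ) : 𝓞 ℚ) ∈ v.asIdeal) {n n₁ : ℕ}
    (hn : ∀ σ ∈ absInertia (v.adicCompletion ℚ), ∀ m : ↥(W.geomPrimaryTorsion p),
      (absGaloisRestrict ℚ (v.adicCompletion ℚ) σ) ^ n • m - m ∈ L.plus)
    (hn₁ : ∀ σ ∈ absInertia (v.adicCompletion ℚ), ∀ m : ↥(W₁.geomPrimaryTorsion p),
      (absGaloisRestrict ℚ (v.adicCompletion ℚ) σ) ^ n₁ • m - m ∈ L₁.plus)
    (hlcm : ¬ (p - 1) ∣ Nat.lcm n n₁)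
    (e : ↥(geomTorsion W (p : ℤ)) ≃+ ↥(geomTorsion W₁ (p : ℤ)))
    (he : ∀ (σ : absoluteGaloisGroup ℚ) (P : ↥(geomTorsion W (p : ℤ))), e (σ • P) = σ • e P)
    (P : ↥(geomTorsion W (p : ℤ))) :
    AddSubgroup.inclusion (geomTorsion_le_geomPrimaryTorsion W p) P ∈ L.plus ↔
      AddSubgroup.inclusion (geomTorsion_le_geomPrimaryTorsion W₁ p) (e P) ∈ L₁.plus :=
  hL.inclusion_mem_iff_of_not_dvd_lcm hL₁ hpv hn hn₁ hlcm e
    (fun σ _ P ↦ he (absGaloisRestrict ℚ (v.adicCompletion ℚ) σ) P) P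

/-- **Existential packaging** (the shape of p07's `exists_lines_matching_*` conclusions, for
consumers quantifying over the lines): off the swap locus, ANY ramified ordinary lines with
exponents `n`, `n₁` match under every congruence. Uniqueness of the lines (S1,
`IsRamifiedOrdinaryLine.eq_of_isRamifiedOrdinaryLine`) makes "any" and "some" the same.
[cite: GreenbergVatsal2000, §2 p. 26 and Remark (2.9)] -/
theorem exists_lines_matching_of_not_dvd_lcm
    {L : LocalDatum ℚ ↥(W.geomPrimaryTorsion p) v} {L₁ : LocalDatum ℚ ↥(W₁.geomPrimaryTorsion p) v}
    (hL : IsRamifiedOrdinaryLine W p L) (hL₁ : IsRamifiedOrdinaryLine W₁ p L₁)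
    (hpv : ((p : ℕ) : 𝓞 ℚ) ∈ v.asIdeal) {n n₁ : ℕ}
    (hn : ∀ σ ∈ absInertia (v.adicCompletion ℚ), ∀ m : ↥(W.geomPrimaryTorsion p),
      (absGaloisRestrict ℚ (v.adicCompletion ℚ) σ) ^ n • m - m ∈ L.plus)
    (hn₁ : ∀ σ ∈ absInertia (v.adicCompletion ℚ), ∀ m : ↥(W₁.geomPrimaryTorsion p),
      (absGaloisRestrict ℚ (v.adicCompletion ℚ) σ) ^ n₁ • m - m ∈ L₁.plus)
    (hlcm : ¬ (p - 1) ∣ Nat.lcm n n₁) :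
    ∃ (L' : LocalDatum ℚ ↥(W.geomPrimaryTorsion p) v)
      (L₁' : LocalDatum ℚ ↥(W₁.geomPrimaryTorsion p) v),
      IsRamifiedOrdinaryLine W p L' ∧ IsRamifiedOrdinaryLine W₁ p L₁' ∧
      ∀ e : ↥(geomTorsion W (p : ℤ)) ≃+ ↥(geomTorsion W₁ (p : ℤ)),
        (∀ (σ : absoluteGaloisGroup ℚ) (P : ↥(geomTorsion W (p : ℤ))), e (σ • P) = σ • e P) →
        ∀ P : ↥(geomTorsion W (p : ℤ)),
          AddSubgroup.inclusion (geomTorsion_le_geomPrimaryTorsion W p) P ∈ L'.plus ↔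
            AddSubgroup.inclusion (geomTorsion_le_geomPrimaryTorsion W₁ p) (e P) ∈ L₁'.plus :=
  ⟨L, L₁, hL, hL₁, fun e he P ↦
    hL.inclusion_mem_iff_of_not_dvd_lcm_of_equivariant hL₁ hpv hn hn₁ hlcm e he P⟩

end Literature.NumberTheory.EllipticCurves.EmertonPollackWeston2006.IsRamifiedOrdinaryLine

end
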